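import Literature.MathematicalPhysics.QuantumFieldTheory.Balaban1983to89.B9SectBGStepAtLettersV2
import Literature.MathematicalPhysics.QuantumFieldTheory.Balaban1983to89.B9Thm34HolderInputGClauseUniformR1

/-!
# `Balaban1983to89.B9SectBE4H2GStepAtLetters` — [Balaban1985BackgroundPropagators] Thm 3.4 p. 400 × Thm 3.3 p. 399 × (3.44)/(3.45) p. 398:
# the tree's Sect. B programme — THE INPUT-HÖLDER BLOCK-STEPS (3.44) ∕ (3.45) OF SECT. B FOR THE BOND-SECTOR FAMILY G(U′U), INHABITED AT THE
# LETTERS, KERNEL-FREE (pub-ymgap N06 row 13, steps 13-E4(G) ∕ 13-H2(G); the G twin of `B9SectBGpStepAtLettersV2.E4H2Frame₂` ∕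
# `stepE4H2Pos_of_e4h2Frame₂`)

statement-level skeleton of published theorems with citation tags; proofs where landed; nothing here is a claim about the Yang–Mills mass gap

CITATION HEADER (lean-in-tree rule).  B9 = T. Bałaban, *Propagators for lattice gauge theories in a background field*, Commun. Math. Phys.
**99** (1985) 389–434 [Balaban1985BackgroundPropagators] (held `paper:balaban1985-cmp99-background-propagators`; journal page = PDF page + 388):
Theorem 3.4 p. 400 [PDF 12] «The extended operators satisfy all the inequalities of Theorems 3.1–3.3 correspondingly»; Theorem 3.3 p. 399
[PDF 11] «with G′(U) replaced by G(U) and λ replaced by a function J defined at bonds of the lattice»; (3.44)–(3.45) p. 398 [PDF 10]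
«|(∇_UG′(U)∇*_Uλ)(x)| ≦ B′₀(ε)(‖λ‖_ε^{ξ′}(L^{j′}η)^ε + |λ|)e^{−δ₀d(y,y′)} for 0 < ε ≦ 1, x ∈ Δ(y), supp λ ⊂ Δ̃(y′)» and its Hölder-output twin;
(3.40) p. 397; p. 403 [PDF 15] l. 1–9 «… of course with different constants»; (3.82)–(3.86) p. 407 [PDF 19] «Thus Theorem 3.4 is proved».
[4] = [Balaban1984PropagatorsII] (2.51)–(2.52) p. 232, Lemma 2.1 p. 234.  Rows B9.Thm3.4 × B9.Thm3.3 ((3.44)/(3.45) cells) × B9.SectB (cells only).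

WHY THIS FILE (pub-ymgap N06 row 13, seat dag-n06-c gen 6; `GSIDE-L2-SPEC.md` §G; sibling of `B9SectBH1GStepAtLetters`).  With `SectBFrame₇`
(`B9SectBStepFrameV7`) the only displayed Sect.-B member-steps are (3.44) ∕ (3.45) of G(U′U).  `B9Thm34HolderInputGClauseUniformR1.
thm34_G_holderInput_clause_uniform` (this lineage, g6) re-runs r06 FILE 57-G on the KERNEL-FREE clause; THIS FILE turns it into the two
block-steps for the `GA` family at the letters, exactly as `B9SectBGpStepAtLettersV2.E4H2Frame₂` ∕ `stepE4H2Pos_of_e4h2Frame₂` did for G′: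
a dictionary `E4H2GFrame₂` = `GFrame₂` + ONE transfer field and ★ `stepE4Pos_of_e4h2GFrame₂`, ★ `stepH2Pos_of_e4h2GFrame₂`.

WHAT IS PROVED (1 structure + 3 theorems: 0 `def` besides the structure, 0 sorry, 0 new named facts; standard axioms):
* `E4H2GFrame₂` — `GFrame₂` plus `wE4G`, `wH2G`, `wHGδ'`, `wHGδ'_pos` and `e4h2G_transfer` (shape = `E4H2Frame₂.e4h2_transfer` on the bond
  carrier `(κ × S i) × ι` for the letter `Gb` and the family `GA`: inputs the (3.42) block and the (3.43)–(3.45) blocks of `GA` at U at rate δ,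
  the per-input (v′) and per-probe (vi′) members for `Gb i (U′U)` at `(B, δc → δc/7)`; output the (3.44) and (3.45) blocks of `GA` at U′U with
  (`wE4G B δc B′₀(·)`, `wHGδ' δc`) and (`wH2G B δc B₀(·) B′₀(·,·)`, `wHGδ' δc`)).  A hypothesis structure; nothing asserted.
* `stepE4H2Pos_of_e4h2GFrame₂` (both blocks in one positive-input step), ★ **`stepE4Pos_of_e4h2GFrame₂`** : `StepE4Pos F.dB c35 geo bg Gp GA
  Cinv GA`, ★ **`stepH2Pos_of_e4h2GFrame₂`** : `StepH2Pos F.dB c35 geo bg Gp GA Cinv GA` — every `E4H2GFrame₂` with a Lemma-2.1 datum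
  `(d261, h261)`.  Proof: `thm34_G_holderInput_clause_uniform` at the call rate `δr = min(min(δ₀,δ₁),δcap)` and exponent `d261 δr`,
  `thm34_Gp_uniform` (R1) for the inverse identities of the G′ extension, the three uniqueness identifications of
  `entries342_ext_of_gFrame₂`, then the frame's transfer field; the projections by `StepPos.mono`.

HONEST SCOPE ∕ NOT CLAIMED.  `E4H2GFrame₂` is a HYPOTHESIS structure, not shown inhabited (instance-level: the (3.44)/(3.45) data of the family
at U as the inputs `N`, `N₂` and the transported Hölder quotients (3.40) as probes — node00-def-Y ∕ dag-n06-d business); r06's theorems and this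
lineage's kernel-free re-runs USED BY NAME; the theorems are quantifier bookkeeping + uniqueness of two-sided inverses.  Nothing of [B9] asserted;
no row head changes; NOT a node discharge; nothing continuum ∕ OS ∕ mass-gap ∕ Clay.  Cell `pub-ymgap` (HUMAN RULING D-0062), Track A node N06
[B9], N06-ASSIGNMENT row 13 (steps 13-E4(G), 13-H2(G)), seat `pub-ymgap-dag-n06-c` (g6), 2026-08-27.  Count-neutral.

RELATED IN THE TREE, NOT DUPLICATED (searched 2026-08-27: `lean search 'E4H2GFrame' --decl` = ∅): `B9SectBGStepAtLettersV2` (`GFrame₂`,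
`entries342_ext_of_gFrame₂` — its two private bookkeeping lemmas re-proved here privately), `B9SectBGpStepAtLettersV2` (`E4H2Frame₂`, the G′
twin; `StepPos.mono` in `B9SectBStepWhole`), `B9Thm34HolderInputGClauseUniformR1`, `B9Thm34SectBUniformR1.thm34_Gp_uniform`,
`B9SectBGStepAtLetters.rZero_add_pPrime_sections` — all USED BY NAME; no existing module modified.
-/

noncomputable section

namespace Literature.MathematicalPhysics.QuantumFieldTheory.Balaban1983to89.B9SectBE4H2GStepAtLetters

open Literature.MathematicalPhysics.QuantumFieldTheory.Balaban1983to89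
open Literature.MathematicalPhysics.QuantumFieldTheory.Balaban1983to89.B6RandomWalk (HasMajorant hasMajorant_mono Triangle254 Ineq261)
open Literature.MathematicalPhysics.QuantumFieldTheory.Balaban1983to89.B6RandomWalkHom (HasMajorantHom)
open Literature.MathematicalPhysics.QuantumFieldTheory.Balaban1983to89.B6RandomWalkSection (secExt secRes secConj secConj_def
  secRes_comp_secExt)
open Literature.MathematicalPhysics.QuantumFieldTheory.Balaban1983to89.B9Thm34Ext (toB6)
open Literature.MathematicalPhysics.QuantumFieldTheory.Balaban1983to89.B9Ineq347 (ScaleTransfer)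
open Literature.MathematicalPhysics.QuantumFieldTheory.Balaban1983to89.B9Eq39Adjoint (covD covDstar prodCfg plaqU)
open Literature.MathematicalPhysics.QuantumFieldTheory.Balaban1983to89.B9Eq369Small (Through)
open Literature.MathematicalPhysics.QuantumFieldTheory.Balaban1983to89.B9Eq372Locality (stBonds)
open Literature.MathematicalPhysics.QuantumFieldTheory.Balaban1983to89.B9Eq352DivForm (tauF tauB)
open Literature.MathematicalPhysics.QuantumFieldTheory.Balaban1983to89.B9Eq352DivFormLetters (conj)
open Literature.MathematicalPhysics.QuantumFieldTheory.Balaban1983to89.B9Eq352GradLetters (diffLetter)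
open Literature.MathematicalPhysics.QuantumFieldTheory.Balaban1983to89.B9Eq371GradLetters (bT bU)
open Literature.MathematicalPhysics.QuantumFieldTheory.Balaban1983to89.B9Eq372RemLetters (lapDDLetter)
open Literature.MathematicalPhysics.QuantumFieldTheory.Balaban1983to89.B9Eq382V3Letters (dPrimeLetter)
open Literature.MathematicalPhysics.QuantumFieldTheory.Balaban1983to89.B9Eq376POneLetters (conjHom gradLin divLin)
open Literature.MathematicalPhysics.QuantumFieldTheory.Balaban1983to89.B9Eq386Neumann (pTwo deltaA)
open Literature.MathematicalPhysics.QuantumFieldTheory.Balaban1983to89.B9Eq360Vprime (gPrimeExtEnd pPrime pOp)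
open Literature.MathematicalPhysics.QuantumFieldTheory.Balaban1983to89.B9Eq360VprimeLetters (vPrimeConc)
open Literature.MathematicalPhysics.QuantumFieldTheory.Balaban1983to89.B9Thm34SectBUniformR1 (thm34_Gp_uniform)
open Literature.MathematicalPhysics.QuantumFieldTheory.Balaban1983to89.B9Thm34GUniformR1 (thm34_G_clause_uniform)
open Literature.MathematicalPhysics.QuantumFieldTheory.Balaban1983to89.B6RandomWalkKernel (HasKernelBound hasKernelBound_mono)
open Literature.MathematicalPhysics.QuantumFieldTheory.Balaban1983to89.B9FromB6 (EBlock)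
open Literature.MathematicalPhysics.QuantumFieldTheory.Balaban1983to89.B9SectBStepWhole (StepPos)
open Literature.MathematicalPhysics.QuantumFieldTheory.Balaban1983to89.B9SectBGpStepAtLettersV2 (GpFrame₂ CinvFrame₂)
open Literature.MathematicalPhysics.QuantumFieldTheory.Balaban1983to89.B9SectBGStepAtLetters (rZero_add_pPrime_sections)
open Literature.MathematicalPhysics.QuantumFieldTheory.Balaban1983to89.B6RandomWalk (BlockSupp)
open Literature.MathematicalPhysics.QuantumFieldTheory.Balaban1983to89.B9Eq352DivFormLetters (coordEquiv)
open Literature.MathematicalPhysics.QuantumFieldTheory.Balaban1983to89.B9FromB6 (E4Block H2Block)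
open Literature.MathematicalPhysics.QuantumFieldTheory.Balaban1983to89.B9SectBStepWhole (StepE4Pos StepH2Pos StepPos.mono)
open Literature.MathematicalPhysics.QuantumFieldTheory.Balaban1983to89.B9SectBGStepAtLettersV2 (GFrame₂)
open Literature.MathematicalPhysics.QuantumFieldTheory.Balaban1983to89.B9Thm34HolderInputGClauseUniformR1 (thm34_G_holderInput_clause_uniform)

universe u

variable {I : Type} (c35 : ℝ) (geo : I → B9.Geometry) (bg : I → B9.Backgrounds)
  (Gp : ∀ i, B9.KernelFamily (geo i) (bg i))
  {𝔸 : Type u} [NormedRing 𝔸] [NormedAlgebra ℂ 𝔸] [CompleteSpace 𝔸] {ι : Type} [Fintype ι] [DecidableEq ι]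
  (b : Module.Basis ι ℝ 𝔸) (κ : Type) [Fintype κ] [LinearOrder κ]
  (S : I → Type) [∀ i, Fintype (S i)] [∀ i, DecidableEq (S i)]
  [∀ i, Fintype (geo i).Site] [∀ i, DecidableEq (geo i).Site] [∀ i, Nonempty (geo i).Site]

/-- Rate bookkeeping for block majorants: a majorant `c·P(a)·e^{−δd}` with `c·P ≧ 0` stays one at any smaller rate `δ′ ≦ δ`
(d ≧ 0). [folklore] [cite: Balaban1984PropagatorsII, (2.51) p.232] -/
private theorem hasMajorant_rate_le {g : B6.Geometry} {X : Type} (blk : X → g.Site) {T : Module.End ℝ (X → ℝ)}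
    {c δ δ' : ℝ} (P : g.Site → ℝ) (hc : ∀ a, 0 ≤ c * P a) (hδ : δ' ≤ δ) (hd : ∀ a a' : g.Site, 0 ≤ g.dist a a')
    (h : HasMajorant blk T (fun a a' => c * P a * Real.exp (-(δ * g.dist a a')))) :
    HasMajorant blk T (fun a a' => c * P a * Real.exp (-(δ' * g.dist a a'))) :=
  hasMajorant_mono blk h fun a a' =>
    mul_le_mul_of_nonneg_left (Real.exp_le_exp.2 (by nlinarith [hd a a', hδ])) (hc a)

/-- The (3.48)-type kernel bound `|T(y,y′)| ≦ c(Lʲη)⁻⁴(L^{j′}η)^{−d}E(y,y′)` w.r.t. the volume pairing `vol g d` is the SAME inequality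
on the matrix entries for every exponent `d` (the factor `(L^{j′}η)^{−d}` IS the reciprocal pairing weight): exponent change `d ↦ D`.
Used to call the r06 chain at a Lemma-2.1 exponent decoupled from the frame's (3.48) exponent `dB`. [folklore]
[cite: Balaban1985BackgroundPropagators, Thm 3.2 (3.48) p.398] -/
private theorem kerBound_exp_change {g : B9.Geometry} [Fintype g.Site] [DecidableEq g.Site]
    (hlen : ∀ y : g.Site, 0 < g.len y) (T : Module.End ℝ (g.Site → ℝ)) {c : ℝ} {E : g.Site → g.Site → ℝ} (d D : ℕ)
    (h : ∀ y y' : g.Site, |B9Thm34Inv.ker (B9Thm34Inv.vol g d) T y y'| ≤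
      c * g.len y ^ (-(4 : ℝ)) * g.len y' ^ (-(d : ℝ)) * E y y') :
    ∀ y y' : g.Site, |B9Thm34Inv.ker (B9Thm34Inv.vol g D) T y y'| ≤
      c * g.len y ^ (-(4 : ℝ)) * g.len y' ^ (-(D : ℝ)) * E y y' := by
  intro y y'
  have hv : ∀ n : ℕ, 0 < B9Thm34Inv.vol g n y' := fun n => B9Thm34Inv.vol_pos n hlen y'
  have h1 := h y y'
  rw [← B9Thm34Inv.vol_inv d hlen y', show c * g.len y ^ (-(4 : ℝ)) * (B9Thm34Inv.vol g d y')⁻¹ * E y y' =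
      (c * g.len y ^ (-(4 : ℝ)) * E y y') * (B9Thm34Inv.vol g d y')⁻¹ by ring] at h1
  have key : |B9Thm34Inv.entry T y y'| ≤ c * g.len y ^ (-(4 : ℝ)) * E y y' :=
    (B9Thm34Inv.ker_le_iff _ (hv d) T y _).1 h1
  have h2 := (B9Thm34Inv.ker_le_iff _ (hv D) T y _).2 key
  rw [B9Thm34Inv.vol_inv D hlen y'] at h2
  calc |B9Thm34Inv.ker (B9Thm34Inv.vol g D) T y y'| ≤ (c * g.len y ^ (-(4 : ℝ)) * E y y') * g.len y' ^ (-(D : ℝ)) := h2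
    _ = c * g.len y ^ (-(4 : ℝ)) * g.len y' ^ (-(D : ℝ)) * E y y' := by ring

/-! ## The letters dictionary for the input-Hölder blocks (3.44) ∕ (3.45) of G -/

/-- **THE LETTERS DICTIONARY FOR THE INPUT-HÖLDER BLOCKS (3.44) ∕ (3.45) OF THE BOND-SECTOR FAMILY G** — `GFrame₂` plus ONE transfer field:
given the (3.42) and (3.43)–(3.45) blocks of `GA` at U and the per-input ∕ per-probe members (v′) (sup output) and (vi′) (Hölder output) for the
family's own `G(U′U)` at the call rate `δc` (outputs at δc∕7), the (3.44) and (3.45) blocks of `GA` hold at U′U with (`wE4G B δc B′₀(·)`,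
`wHGδ' δc`) and (`wH2G B δc B₀(·) B′₀(·,·)`, `wHGδ' δc`).  Field shapes = the conclusions (v), (vi) of
`B9Thm34HolderInputGClauseUniformR1.thm34_G_holderInput_clause_uniform` read for the letter `Gb`.  A hypothesis structure; nothing asserted.
[cite: Balaban1985BackgroundPropagators, Thm 3.3 p.399 + (3.44)–(3.45) p.398 + (3.40) p.397 + Thm 3.4 p.400 + p.403 l.2–5 + (3.86) p.407; Balaban1984PropagatorsII, (2.51)–(2.52) p.232 + Lemma 2.1 p.234] -/
structure E4H2GFrame₂ (GA : ∀ i, B9.KernelFamily (geo i) (bg i)) (Cinv : ∀ i, B9.SiteKernel (geo i) (bg i))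
    extends GFrame₂ c35 geo bg Gp b κ S GA Cinv where
  wE4G : ℝ → ℝ → (ℝ → ℝ) → (ℝ → ℝ)
  wH2G : ℝ → ℝ → (ℝ → ℝ) → (ℝ → ℝ → ℝ) → (ℝ → ℝ → ℝ)
  wHGδ' : ℝ → ℝ
  wHGδ'_pos : ∀ δ : ℝ, 0 < δ → 0 < wHGδ' δ
  /-- THE TRANSFER (at a call rate `δc ≦ δ`): the per-input (v′) and per-probe (vi′) input-Hölder members (inputs at rate δc, outputs at δc∕7)
  for the family's `G(U′U)` ⇒ the (3.44), (3.45) blocks of `GA` at U′U, given the (3.42) ∕ (3.43)–(3.45) blocks of `GA` at U at rate δ. -/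
  e4h2G_transfer : ∀ i (α₀ : ℝ) (U U' : (bg i).Cfg) (α₁ B₀ B δ δc : ℝ) (Bβ Bε : ℝ → ℝ) (Bεβ : ℝ → ℝ → ℝ),
    MInv ≤ (geo i).M → 0 < α₀ → (geo i).M * α₀ ≤ aInv → (bg i).Reg335 c35 α₀ U →
    0 < α₁ → α₁ ≤ aW → (bg i).Cplx337 α₁ U U' → 0 < B₀ → 0 ≤ B → 0 < δ → 0 < δc → δc ≤ δ →
    EBlock (GA i) B₀ δ U → B9.Ineq343_345 (GA i) Bβ Bε Bεβ δ U →
    -- (v′) the (3.44)-type member AT THE CALL RATE δc ≦ δ (output δc∕7), per pair of letters and per input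
      (∀ (Dl Ds : Module.End ℝ ((κ × S i) × ι → ℝ)),
        HasMajorant (g := toB6 (geo i) (Rr i) (Hp i)) (fun q : (κ × S i) × ι => blk i q.1.2) (Dl * Gb i U) (fun a a' => cRG * B₀ * (geo i).len a * Real.exp (-(δc * (geo i).dist a a'))) →
        HasMajorant (g := toB6 (geo i) (Rr i) (Hp i)) (fun q : (κ × S i) × ι => blk i q.1.2) (Gb i U * Ds) (fun a a' => cRG * B₀ * (geo i).len a * Real.exp (-(δc * (geo i).dist a a'))) →
      ∀ (y' : (geo i).Site) (μ : (κ × S i) × ι → ℝ) (M : ℝ), BlockSupp (g := toB6 (geo i) (Rr i) (Hp i)) (fun q : (κ × S i) × ι => blk i q.1.2) μ y' M →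
      ∀ (N : ℝ), 0 ≤ N →
        (∀ (k : κ ⊕ κ) (z : (κ × S i) × ι), |(((conj b (diffLetter (bT (T i)) (bU (coord i U)) ((((geo i).eta : ℂ))⁻¹) k)) * Gb i U * Ds) μ) z| ≤ N * Real.exp (-(δc * (geo i).dist (blk i z.1.2) y'))) →
        (∀ z : (κ × S i) × ι, |((Dl * Gb i U * Ds) μ) z| ≤ N * Real.exp (-(δc * (geo i).dist (blk i z.1.2) y'))) →
        ∀ x : (κ × S i) × ι, |((Dl * Gb i ((bg i).mul U' U) * Ds) μ) x| ≤ B * (N + M) * Real.exp (-(δc / 7 * (geo i).dist (blk i x.1.2) y'))) →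
    -- (vi′) the (3.45)-type member AT THE CALL RATE δc, per pair of letters, per probe and per input
      (∀ (Dl Ds : Module.End ℝ ((κ × S i) × ι → ℝ)),
        HasMajorant (g := toB6 (geo i) (Rr i) (Hp i)) (fun q : (κ × S i) × ι => blk i q.1.2) (Dl * Gb i U) (fun a a' => cRG * B₀ * (geo i).len a * Real.exp (-(δc * (geo i).dist a a'))) →
        HasMajorant (g := toB6 (geo i) (Rr i) (Hp i)) (fun q : (κ × S i) × ι => blk i q.1.2) (Gb i U * Ds) (fun a a' => cRG * B₀ * (geo i).len a * Real.exp (-(δc * (geo i).dist a a'))) →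
      ∀ (Φ : (κ × S i → 𝔸) →ₗ[ℝ] 𝔸) (y : (geo i).Site) (p₀ : (κ × S i) × ι), blk i p₀.1.2 = y →
      ∀ (γ Bh cζ : ℝ), 0 ≤ Bh → 0 ≤ cζ →
        (∀ (y'' : (geo i).Site) (ν : (κ × S i) × ι → ℝ) (C : ℝ), BlockSupp (g := toB6 (geo i) (Rr i) (Hp i)) (fun q : (κ × S i) × ι => blk i q.1.2) ν y'' C →
          ‖Φ ((coordEquiv b).symm (Dl (Gb i U ν)))‖ ≤ Bh * (geo i).len y ^ (1 - γ) * cζ * Real.exp (-(δc * (geo i).dist y y'')) * C) →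
      ∀ (y' : (geo i).Site) (μ : (κ × S i) × ι → ℝ) (M : ℝ), BlockSupp (g := toB6 (geo i) (Rr i) (Hp i)) (fun q : (κ × S i) × ι => blk i q.1.2) μ y' M →
      ∀ (N : ℝ), 0 ≤ N →
        (∀ (k : κ ⊕ κ) (z : (κ × S i) × ι), |(((conj b (diffLetter (bT (T i)) (bU (coord i U)) ((((geo i).eta : ℂ))⁻¹) k)) * Gb i U * Ds) μ) z| ≤ N * Real.exp (-(δc * (geo i).dist (blk i z.1.2) y'))) →
      ∀ (N₂ : ℝ), 0 ≤ N₂ → ‖Φ ((coordEquiv b).symm ((Dl * Gb i U * Ds) μ))‖ ≤ N₂ * Real.exp (-(δc * (geo i).dist y y')) →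
        ‖Φ ((coordEquiv b).symm ((Dl * Gb i ((bg i).mul U' U) * Ds) μ))‖ ≤
          B * (N₂ + Bh * (geo i).len y ^ (1 - γ) * cζ * ((geo i).len y)⁻¹ * (N + M)) * Real.exp (-(δc / 7 * (geo i).dist y y'))) →
    E4Block (GA i) (wE4G B δc Bε) (wHGδ' δc) ((bg i).mul U' U) ∧
      H2Block (GA i) (wH2G B δc Bβ Bεβ) (wHGδ' δc) ((bg i).mul U' U)

variable {c35 geo bg Gp b κ S}

/-! ## ★ The (3.44)- and (3.45)-steps of Sect. B for G(U′U) at the letters -/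

/-- **The two input-Hölder blocks of G(U′U) at the letters, in one positive-input step (product of outputs), KERNEL-FREE.**  Proof:
`B9Thm34HolderInputGClauseUniformR1.thm34_G_holderInput_clause_uniform` (constants before the member; NO kernel-form letter),
`thm34_Gp_uniform` (R1) for the inverse identities of the G′ extension, the three uniqueness identifications of
`B9SectBGStepAtLettersV2.entries342_ext_of_gFrame₂`, then the frame's transfer field.
[cite: Balaban1985BackgroundPropagators, Thm 3.4 p.400 + Thm 3.3 p.399 + (3.44)–(3.45) p.398 + (3.80)–(3.86) p.407 + (3.57)–(3.68) pp.402–403 + Thm 3.11 p.416; Balaban1984PropagatorsII, Lemma 2.1 (2.61) p.234] -/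
theorem stepE4H2Pos_of_e4h2GFrame₂ {GA : ∀ i, B9.KernelFamily (geo i) (bg i)} {Cinv : ∀ i, B9.SiteKernel (geo i) (bg i)}
    (F : E4H2GFrame₂ c35 geo bg Gp b κ S GA Cinv) (d261 : ℝ → ℕ)
    (h261 : ∀ (i : I) (δ α : ℝ), 0 < δ → δ ≤ F.δcap → 9 / 5000 ≤ α → α < 1 → F.M261 δ ≤ (geo i).M →
      Ineq261 (d261 δ) (toB6 (geo i) (F.Rr i) (F.Hp i)) δ α) :
    StepPos F.dB c35 geo bg Gp GA Cinv (((ℝ → ℝ) × ℝ) × ((ℝ → ℝ → ℝ) × ℝ)) (fun c => 0 < c.1.2 ∧ 0 < c.2.2)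
      (fun c i U α₁ => ∀ U' : (bg i).Cfg, (bg i).Cplx337 α₁ U U' →
        E4Block (GA i) c.1.1 c.1.2 ((bg i).mul U' U) ∧ H2Block (GA i) c.2.1 c.2.2 ((bg i).mul U' U)) := by
  intro B₀ δ₀ Bβ Bε Bεβ B₁ δ₁ hB₀ hδ₀ hB₁ hδ₁
  classical
  -- the common rate of the call
  have hδr : 0 < min (min δ₀ δ₁) F.δcap := lt_min (lt_min hδ₀ hδ₁) F.δcap_pos
  have hδr0 : min (min δ₀ δ₁) F.δcap ≤ δ₀ := le_trans (min_le_left _ _) (min_le_left _ _)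
  have hδr1 : min (min δ₀ δ₁) F.δcap ≤ δ₁ := le_trans (min_le_left _ _) (min_le_right _ _)
  have hδrc : min (min δ₀ δ₁) F.δcap ≤ F.δcap := min_le_right _ _
  have hBG : 0 < F.cR * B₀ := mul_pos F.cR_pos hB₀
  have hBb : 0 < F.cRG * B₀ := mul_pos F.cRG_pos hB₀
  have hBK : 0 < F.cK * B₁ := mul_pos F.cK_pos hB₁
  -- r06's uniform Theorem-3.4 clauses: G′ (for the inverse identities of the extension) and G
  obtain ⟨a₁, ha₁, B', -, H'⟩ := thm34_Gp_uniform b κ (d261 (min (min δ₀ δ₁) F.δcap)) (min (min δ₀ δ₁) F.δcap) (F.cR * B₀) F.Cq F.a₀ F.d₀ F.M₂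
    (F.Λf (min (min δ₀ δ₁) F.δcap)) hBG F.Cq_nonneg F.a₀_nonneg F.M₂_nonneg hδr
    (fun α hα => F.Λf_one_le _ α hδr hα) F.hrepr
  obtain ⟨a₂, ha₂, B, hB, H⟩ := thm34_G_holderInput_clause_uniform b κ (d261 (min (min δ₀ δ₁) F.δcap)) (min (min δ₀ δ₁) F.δcap) (F.cRG * B₀) F.κQ (F.cR * B₀)
    (F.cK * B₁) F.cF F.Cq F.a₀ F.C₀ F.d₀ F.M₂ F.κQb F.cFb F.abar (F.Λf (min (min δ₀ δ₁) F.δcap)) hBb.le F.κQ_pos hBG hBK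
    F.cF_pos F.Cq_nonneg F.a₀_nonneg F.C₀_nonneg F.M₂_nonneg hδr F.κQb_nonneg F.cFb_nonneg F.abar_nonneg
    (fun α hα => F.Λf_one_le _ α hδr hα) hBb F.hrepr
  refine ⟨F.Mthr (min (min δ₀ δ₁) F.δcap), min (min a₁ a₂) F.aW, F.aInv,
    ((F.wE4G B (min (min δ₀ δ₁) F.δcap) Bε, F.wHGδ' (min (min δ₀ δ₁) F.δcap)),
      (F.wH2G B (min (min δ₀ δ₁) F.δcap) Bβ Bεβ, F.wHGδ' (min (min δ₀ δ₁) F.δcap))), F.Mthr_pos _,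
    lt_min (lt_min ha₁ ha₂) F.aW_pos, F.aInv_pos, ⟨F.wHGδ'_pos _ hδr, F.wHGδ'_pos _ hδr⟩, ?_⟩
  intro i hM0 α₀ hα₀ hMa U hU hT α₁ hα₁ ha' U' hU'
  have ha : α₁ ≤ min a₁ a₂ := le_trans ha' (min_le_left _ _)
  have haW : α₁ ≤ F.aW := le_trans ha' (min_le_right _ _)
  have hEp : EBlock (Gp i) B₀ δ₀ U := hT.1.1.1
  have hKer := hT.2.1
  have hEG : EBlock (GA i) B₀ δ₀ U := hT.2.2.1.1
  have hHH : B9.Ineq343_345 (GA i) Bβ Bε Bεβ δ₀ U := hT.2.2.2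
  have hM : F.MInv ≤ (geo i).M := F.MInv_le_of_Mthr_le hM0
  have ha1 : α₁ ≤ a₁ := le_trans ha (min_le_left _ _)
  have ha2 : α₁ ≤ a₂ := le_trans ha (min_le_right _ _)
  -- the site-sector letters at U: G′(U) inverts Δ′_a(U); (3.42)₀,₁,₂ of G′ at δ₀ lowered to δr
  obtain ⟨hΔG, hGΔ⟩ := F.reg_inv i α₀ U hM hα₀ hMa hU
  obtain ⟨h1, h2, h3, -⟩ := F.read342 i α₀ U B₀ δ₀ hM hα₀ hMa hU hB₀ hδ₀ hEp
  have hc2 : ∀ a : (geo i).Site, 0 ≤ F.cR * B₀ * (geo i).len a ^ 2 := fun a => mul_nonneg hBG.le (sq_nonneg _)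
  have hc1 : ∀ a : (geo i).Site, 0 ≤ F.cR * B₀ * (geo i).len a := fun a => mul_nonneg hBG.le (F.len_pos i a).le
  have h1' := hasMajorant_rate_le (g := toB6 (geo i) (F.Rr i) (F.Hp i)) (fun p : S i × ι => F.blk i p.1)
    (fun a => (geo i).len a ^ 2) hc2 hδr0 (F.dist_nonneg i) h1
  have h2' := fun k => hasMajorant_rate_le (g := toB6 (geo i) (F.Rr i) (F.Hp i)) (fun p : S i × ι => F.blk i p.1)
    (fun a => (geo i).len a) hc1 hδr0 (F.dist_nonneg i) (h2 k)
  have h3' := fun k => hasMajorant_rate_le (g := toB6 (geo i) (F.Rr i) (F.Hp i)) (fun p : S i × ι => F.blk i p.1)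
    (fun a => (geo i).len a) hc1 hδr0 (F.dist_nonneg i) (h3 k)
  -- the (3.48) kernel of C⁻¹(U) at δ₁ lowered to δr
  have hK := F.readKer i α₀ U B₁ δ₁ hM hα₀ hMa hU hB₁ hδ₁ hKer
  have hK' : ∀ y y' : (geo i).Site, |B9Thm34Inv.ker (B9Thm34Inv.vol (geo i) F.dB) (F.Cop i U) y y'| ≤
      F.cK * B₁ * (geo i).len y ^ (-(4 : ℝ)) * (geo i).len y' ^ (-(F.dB : ℝ)) *
        Real.exp (-(min (min δ₀ δ₁) F.δcap * (geo i).dist y y')) := by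
    intro y y'
    refine (hK y y').trans (mul_le_mul_of_nonneg_left (Real.exp_le_exp.2 ?_) ?_)
    · nlinarith [F.dist_nonneg i y y', hδr1]
    · exact mul_nonneg (mul_nonneg hBK.le (Real.rpow_nonneg (F.len_pos i y).le _))
        (Real.rpow_nonneg (F.len_pos i y').le _)
  -- the Lemma-2.1 exponent of the call is `d261 δr`, decoupled from the (3.48) exponent `dB`: the kernel bound is exponent-free
  have hK'' := kerBound_exp_change (F.len_pos i) (F.Cop i U) F.dB (d261 (min (min δ₀ δ₁) F.δcap)) hK'
  -- the bond-sector letters at U: G(U) inverts Δ_a(U); (3.42) of G at δ₀ lowered to δr; (3.15) sizes at δr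
  obtain ⟨hΔGb, hGbΔ⟩ := F.reg_ginv i α₀ U hM hα₀ hMa hU
  obtain ⟨g1, g2, g3, -⟩ := F.readG342 i α₀ U B₀ δ₀ hM hα₀ hMa hU hB₀ hδ₀ hEG
  have hb2 : ∀ a : (geo i).Site, 0 ≤ F.cRG * B₀ * (geo i).len a ^ 2 := fun a => mul_nonneg hBb.le (sq_nonneg _)
  have hb1 : ∀ a : (geo i).Site, 0 ≤ F.cRG * B₀ * (geo i).len a := fun a => mul_nonneg hBb.le (F.len_pos i a).le
  have g1' := hasMajorant_rate_le (g := toB6 (geo i) (F.Rr i) (F.Hp i)) (fun q : (κ × S i) × ι => F.blk i q.1.2)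
    (fun a => (geo i).len a ^ 2) hb2 hδr0 (F.dist_nonneg i) g1
  have g2' := fun k => hasMajorant_rate_le (g := toB6 (geo i) (F.Rr i) (F.Hp i)) (fun q : (κ × S i) × ι => F.blk i q.1.2)
    (fun a => (geo i).len a) hb1 hδr0 (F.dist_nonneg i) (g2 k)
  have g3' := fun k => hasMajorant_rate_le (g := toB6 (geo i) (F.Rr i) (F.Hp i)) (fun q : (κ × S i) × ι => F.blk i q.1.2)
    (fun a => (geo i).len a) hb1 hδr0 (F.dist_nonneg i) (g3 k)
  have hQb := F.hQb i U _ hδr hδrc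
  have hQsb := F.hQsb i U _ hδr hδrc
  -- the class (3.37) read blockwise; the (3.57), (3.80)–(3.81) letters; (3.35) on plaquettes
  obtain ⟨hkF, hsF, h337B, h337F, h337Bτ, hA, hAτB⟩ := F.cplx i α₁ U U' hα₁ hU'
  obtain ⟨h337B', h337FB, hAτF, hAFB, hAst, hAloc, hdAst⟩ := F.cplxG i α₁ U U' hα₁ hU'
  obtain ⟨hQm, hQsm⟩ := F.q_mul i α₁ U U' hα₁ hU'
  obtain ⟨hFc, hFcs⟩ := F.hF i α₁ U U' hα₁ hU'
  obtain ⟨hQbm, hQsbm⟩ := F.qb_mul i α₁ U U' hα₁ hU'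
  obtain ⟨hF₂, hF₂s⟩ := F.hF₂ i α₁ U U' hα₁ hU' _ hδr hδrc
  have h35 := F.reg335 i α₀ U hM hα₀ hMa hU
  -- the G′ clause: the inverse identities of the extension ⇒ the family's G′(U′U) is r06's extension
  obtain ⟨hinv1, hinv2, -, -⟩ := H' (F.T i) (F.coord i U) (F.blk i) (F.kQ i U) (F.sQ i U) (F.cfun i) (F.w i U)
    (F.dist_nonneg i) (F.triangle i) (F.dist_self i) (F.dist_comm i) (F.len_pos i) (F.eta_le_len i) (F.eta_pos i)
    (fun α hα hα1 => h261 i _ α hδr hδrc hα hα1 (F.M261_le_of_Mthr_le hM0)) (F.hST_of i hδr hδrc hM0) (F.unitary i U)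
    (F.stencilB i) (F.stencilF i) (F.stencil0 i) (F.w_nonneg i U) (F.card_w i U) (F.hkQ i U) (F.hsQ i U) (F.hcfun i)
    hΔG hGΔ h1' h2' h3' α₁ hα₁.le ha1 (F.expA i U U') (F.kF i U U') (F.sF i U U')
    hkF hsF h337B h337F h337Bτ hA hAτB
  have hGp := F.gop_eq i ((bg i).mul U' U) _ _ (F.mul_law i α₁ U U' hα₁ hU') hinv1 hinv2
  -- the kernel-free G input-Hölder clause: identities + the (3.44)/(3.45)-type members of r06's GExt per input / per probe
  obtain ⟨Tinv, GExt, hT1, hT2, hG1, hG2, hHv, hHvi⟩ := H (F.T i) (F.coord i U) (F.blk i) (F.kQ i U) (F.sQ i U)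
    (F.cfun i) (F.w i U)
    (F.dist_nonneg i) (F.triangle i) (F.dist_self i) (F.dist_comm i) (F.len_pos i) (F.eta_le_len i) (F.eta_pos i)
    (F.L_one_le i) (fun α hα hα1 => h261 i _ α hδr hδrc hα hα1 (F.M261_le_of_Mthr_le hM0)) (F.hST_of i hδr hδrc hM0) (F.T_comm i)
    (F.unitary i U) h35 (F.stencilB i) (F.stencilF i) (F.stencilFB i) (F.stencilSt i) (F.stencilLoc i) (F.stencil0 i)
    (F.w_nonneg i U) (F.card_w i U) (F.hkQ i U) (F.hsQ i U) (F.hcfun i)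
    h1' h2' h3' (F.rep i) (F.hrep i) (F.hQc i U) (F.hQcs i U) (F.reg_cinv i α₀ U hM hα₀ hMa hU) hK''
    hQb hQsb (F.ha324 i) hΔGb hGbΔ g1' g2' g3' α₁ hα₁.le ha2 (F.expA i U U') (F.kF i U U') (F.sF i U U')
    hkF hsF h337B h337F h337B' h337Bτ h337FB hA hAτB hAτF hAFB hAst hAloc hdAst hQm hQsm hFc hFcs hQbm hQsbm rfl hF₂ hF₂s
  -- (1) G′(U′U) = r06's extension; (2) C⁻¹(U′U) = r06's Tinv
  rw [← hGp] at hT1 hT2 hG1 hG2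
  have hC := F.cop_eq i ((bg i).mul U' U) _ Tinv rfl hT1 hT2
  rw [← hC] at hG1 hG2
  -- (3) the section identity: R₀ + P′(A) through `rep` is P(U′U) read directly; (4) the background of U′U
  have hinj : Function.Injective (F.rep i) := fun y₁ y₂ h => by
    have e := congrArg (fun p : S i × ι => F.blk i p.1) h
    simpa only [F.hrep] using e
  rw [rZero_add_pPrime_sections hinj, ← F.coord_mul i α₁ U U' hα₁ hU'] at hG1 hG2
  -- (5) G(U′U) = r06's GExt
  have hGb := F.gb_eq i ((bg i).mul U' U) _ GExt rfl hG1 hG2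
  rw [← hGb] at hHv hHvi
  exact F.e4h2G_transfer i α₀ U U' α₁ B₀ B δ₀ (min (min δ₀ δ₁) F.δcap) Bβ Bε Bεβ hM hα₀ hMa hU hα₁ haW hU' hB₀ hB hδ₀ hδr hδr0
    hEG hHH hHv hHvi

/-- ★ **THE (3.44)-STEP OF SECT. B FOR G(U′U), INHABITED AT THE LETTERS, KERNEL-FREE** (projection of `stepE4H2Pos_of_e4h2GFrame₂`).
[cite: Balaban1985BackgroundPropagators, Thm 3.4 p.400 + Thm 3.3 p.399 + (3.44) p.398 + p.403 l.2–5] -/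
theorem stepE4Pos_of_e4h2GFrame₂ {GA : ∀ i, B9.KernelFamily (geo i) (bg i)} {Cinv : ∀ i, B9.SiteKernel (geo i) (bg i)}
    (F : E4H2GFrame₂ c35 geo bg Gp b κ S GA Cinv) (d261 : ℝ → ℕ)
    (h261 : ∀ (i : I) (δ α : ℝ), 0 < δ → δ ≤ F.δcap → 9 / 5000 ≤ α → α < 1 → F.M261 δ ≤ (geo i).M →
      Ineq261 (d261 δ) (toB6 (geo i) (F.Rr i) (F.Hp i)) δ α) :
    StepE4Pos F.dB c35 geo bg Gp GA Cinv GA :=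
  StepPos.mono (fun c => c.1) (fun _ h => h.1) (fun _ _ _ _ _ h U' hU' => (h U' hU').1) (stepE4H2Pos_of_e4h2GFrame₂ F d261 h261)

/-- ★ **THE (3.45)-STEP OF SECT. B FOR G(U′U), INHABITED AT THE LETTERS, KERNEL-FREE** (projection of `stepE4H2Pos_of_e4h2GFrame₂`).
[cite: Balaban1985BackgroundPropagators, Thm 3.4 p.400 + Thm 3.3 p.399 + (3.45) p.398 + p.403 l.2–5] -/
theorem stepH2Pos_of_e4h2GFrame₂ {GA : ∀ i, B9.KernelFamily (geo i) (bg i)} {Cinv : ∀ i, B9.SiteKernel (geo i) (bg i)}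
    (F : E4H2GFrame₂ c35 geo bg Gp b κ S GA Cinv) (d261 : ℝ → ℕ)
    (h261 : ∀ (i : I) (δ α : ℝ), 0 < δ → δ ≤ F.δcap → 9 / 5000 ≤ α → α < 1 → F.M261 δ ≤ (geo i).M →
      Ineq261 (d261 δ) (toB6 (geo i) (F.Rr i) (F.Hp i)) δ α) :
    StepH2Pos F.dB c35 geo bg Gp GA Cinv GA :=
  StepPos.mono (fun c => c.2) (fun _ h => h.2) (fun _ _ _ _ _ h U' hU' => (h U' hU').2) (stepE4H2Pos_of_e4h2GFrame₂ F d261 h261)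

end Literature.MathematicalPhysics.QuantumFieldTheory.Balaban1983to89.B9SectBE4H2GStepAtLetters
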